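import Literature.AlgebraicGeometry.AbelianSchemes.AbelianSchemeUnitSectionChart
import HarnessLib

/-!
# Fibres of an abelian scheme are unchanged by an intermediate base change
# (Shimura 1998 §12.4 Prop. 26, proof p. 109; Görtz–Wedhorn (4.7) «transitivity of base change»)

Topic `Literature/AlgebraicGeometry/AbelianSchemes`; namespace `Literature.AlgebraicGeometry.AbelianSchemes.AbelianScheme`.
Cell `hodgecm-mathlib` (D-0151), row II-2β, A-p14's cut S1-F2c (C5, 04:21:17Z): after replacing the base `R` of a model `𝒜` by
`R' = R[1/s]` (the unit-section chart of `AbelianSchemeUnitSectionChart`), the fibre of `𝒜_{R'}` at a point `φ' : R' → κ` IS the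
fibre of `𝒜` at `φ' ∘ f` — so A-p14's identification `e : 𝒜.fibre ψ ≅ A` over `ℂ` survives the localisation.  SEQUEL of
`AbelianSchemeFibreEndomorphisms` (`fibre`, `fibreEnd`) and `AbelianSchemeUnitSectionChart` (`RingAction.baseChange`).  CM-free;
three definitions with body (isomorphisms) + theorems; no named fact, no `instance`, no `sorry` (net debt 0).
HC_CM is proved only modulo the 7 printed citations until rung 0 closes.

THE MATHEMATICS.  `Spec (φ' ∘ f) = Spec φ' ≫ Spec f`, so pulling back along `Spec (φ' ∘ f)` is pulling back along `Spec f` and then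
along `Spec φ'` (Mathlib `Over.pullbackComp`, transitivity of fibre products [GortzWedhorn2020, (4.7)]); the natural isomorphism is
automatically MONOIDAL for the cartesian structures (Mathlib `NatTrans.IsMonoidal.of_cartesianMonoidalCategory`), hence lifts to
group objects (`Functor.mapGrpNatIso`, `Functor.mapGrpCompIso`) — i.e. to an isomorphism of abelian varieties over `κ`, natural in
group-scheme endomorphisms of `𝒜` (so it intertwines the specialised endomorphisms `fibreEnd`).

WHAT IS HERE (`𝒜 : AbelianScheme R`, `f : R →+* R'`, `φ' : R' →+* κ`, `κ` a field).
* `specMap_comp` (`Spec (φ' ∘ f) = Spec φ' ≫ Spec f`), `pullbackSpecCompIso` (`Over.pullback (Spec (φ' ∘ f)) ≅ Over.pullback (Spec f) ⋙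
  Over.pullback (Spec φ')`), `fibreToGrpBaseChangeIso` (the induced iso of group `κ`-schemes).
* **`fibreBaseChangeIso : (𝒜.baseChange f).fibre φ' ≅ 𝒜.fibre (φ'.comp f)`** in `AbelianVariety κ`.
* `fibreCongrIso (h : φ₁ = φ₂) : 𝒜.fibre φ₁ ≅ 𝒜.fibre φ₂` (equal points have equal fibres — for `ψ'.comp (algebraMap R R') = ψ`
  after extending a point to a localisation) with `fibreEnd_comp_fibreCongrIso_hom`.
* **`fibreEnd_baseChange_comp_fibreBaseChangeIso_hom`**: for a group-scheme endomorphism `g` of `𝒜`,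
  `(𝒜_{R'}).fibreEnd φ' (g_{R'}) ≫ iso.hom = iso.hom ≫ 𝒜.fibreEnd (φ' ∘ f) g` (naturality of the lifted iso), and its `RingAction`
  form `fibreEnd_ringAction_baseChange_comp_fibreBaseChangeIso_hom` for the tree's `RingAction.baseChange`.

## References
* [Shimura1998] G. Shimura, *Abelian Varieties with Complex Multiplication and Modular Functions* (1998), §12.4 Prop. 26 (proof p. 109).
* [GortzWedhorn2020] U. Görtz, T. Wedhorn, *Algebraic Geometry I* (2020), Section (4.7) (transitivity of base change), Remark 16.54.
-/

set_option autoImplicit false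

universe u v

open CategoryTheory CategoryTheory.Limits AlgebraicGeometry MonoidalCategory

noncomputable section

namespace Literature.AlgebraicGeometry.AbelianSchemes

open Literature.AlgebraicGeometry.Motives (SchemeOver AbelianVariety)
open scoped MonObj Obj

namespace AbelianScheme

variable {R : Type u} [CommRing R] (𝒜 : AbelianScheme R) {R' : Type u} [CommRing R'] (f : R →+* R')
  {κ : Type u} [Field κ] (φ' : R' →+* κ)

/-- `Spec (φ' ∘ f) = Spec φ' ≫ Spec f`. [cite: GortzWedhorn2020, Section (4.7)] -/
theorem specMap_comp : specMap (φ'.comp f) = specMap φ' ≫ specMap f := by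
  change Spec.map (CommRingCat.ofHom (φ'.comp f)) = _
  rw [CommRingCat.ofHom_comp, Spec.map_comp]

/-- **Transitivity of base change** for the functors: `Over.pullback (Spec (φ' ∘ f)) ≅ Over.pullback (Spec f) ⋙ Over.pullback (Spec φ')`
(Mathlib `Over.pullbackComp` along `specMap_comp`). [cite: GortzWedhorn2020, Section (4.7)] -/
def pullbackSpecCompIso :
    (Over.pullback (specMap (φ'.comp f)) : SchemeOver R ⥤ SchemeOver κ) ≅
      Over.pullback (specMap f) ⋙ Over.pullback (specMap φ') :=
  eqToIso (congrArg (fun g => (Over.pullback g : SchemeOver R ⥤ SchemeOver κ)) (specMap_comp f φ')) ≪≫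
    Over.pullbackComp (specMap φ') (specMap f)

/-- The induced isomorphism of GROUP `κ`-schemes `(𝒜_{φ' ∘ f})^grp ≅ ((𝒜_{R'})_{φ'})^grp`: the natural iso `pullbackSpecCompIso` is
monoidal for the cartesian structures (Mathlib `NatTrans.IsMonoidal.of_cartesianMonoidalCategory`), so it lifts to group objects
(`Functor.mapGrpNatIso`), and `(F ⋙ G).mapGrp ≅ F.mapGrp ⋙ G.mapGrp` (`Functor.mapGrpCompIso`). [cite: GortzWedhorn2020, Remark 16.54] -/
def fibreToGrpBaseChangeIso : (𝒜.fibre (φ'.comp f)).toGrp ≅ ((𝒜.baseChange f).fibre φ').toGrp :=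
  (Functor.mapGrpNatIso (pullbackSpecCompIso f φ') ≪≫ Functor.mapGrpCompIso).app 𝒜.toGrp

/-- **The fibre of `𝒜_{R'}` at `φ'` is the fibre of `𝒜` at `φ' ∘ f`**, as abelian varieties over `κ`:
`(𝒜.baseChange f).fibre φ' ≅ 𝒜.fibre (φ'.comp f)`.  (Shimura: the specialisation does not see an intermediate localisation of
the base of the model.) [cite: Shimura1998, §12.4 Prop. 26 (proof, p. 109)] [cite: GortzWedhorn2020, Section (4.7)] -/
def fibreBaseChangeIso : (𝒜.baseChange f).fibre φ' ≅ 𝒜.fibre (φ'.comp f) :=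
  (InducedCategory.isoMk (X := 𝒜.fibre (φ'.comp f)) (Y := (𝒜.baseChange f).fibre φ')
    (𝒜.fibreToGrpBaseChangeIso f φ')).symm

/-- The underlying morphism of group schemes of `fibreBaseChangeIso.hom` is the inverse of the lifted natural iso (by definition).
[cite: GortzWedhorn2020, Section (4.7)] -/
theorem fibreBaseChangeIso_hom_hom : (𝒜.fibreBaseChangeIso f φ').hom.hom = (𝒜.fibreToGrpBaseChangeIso f φ').inv := rfl

/-- **The iso intertwines specialised endomorphisms**: for a group-scheme endomorphism `g` of `𝒜` with base change
`g_{R'} := (Over.pullback (Spec f)).map g` (a homomorphism of `𝒜_{R'}`, e.g. by `RingAction.baseChange`, or Mathlib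
`Functor.map.instIsMonHom`), `(𝒜_{R'}).fibreEnd φ' g_{R'} ≫ iso.hom = iso.hom ≫ 𝒜.fibreEnd (φ' ∘ f) g` — naturality of
`fibreToGrpBaseChangeIso` in the group-scheme morphism `g`. [cite: Shimura1998, §12.4 Prop. 26 (proof, p. 109)]
[cite: GortzWedhorn2020, Remark 16.54] -/
theorem fibreEnd_baseChange_comp_fibreBaseChangeIso_hom (g : 𝒜.X ⟶ 𝒜.X) [IsMonHom g]
    [IsMonHom (M := (𝒜.baseChange f).X) (N := (𝒜.baseChange f).X) ((Over.pullback (specMap f)).map g)] :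
    (𝒜.baseChange f).fibreEnd φ' ((Over.pullback (specMap f)).map g) ≫ (𝒜.fibreBaseChangeIso f φ').hom =
      (𝒜.fibreBaseChangeIso f φ').hom ≫ 𝒜.fibreEnd (φ'.comp f) g := by
  apply AbelianVariety.hom_ext
  have nat := (Functor.mapGrpNatIso (pullbackSpecCompIso f φ') ≪≫
    (Functor.mapGrpCompIso (F := Over.pullback (specMap f)) (G := Over.pullback (specMap φ')))).inv.naturality (Grp.ofHom g)
  exact congrArg (fun t => t.hom.hom) nat

/-- The `RingAction` form: for a presented ring action `act` on `𝒜` and its base change `act.baseChange f`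
(`AbelianSchemeUnitSectionChart`), the iso intertwines `(𝒜_{R'}).fibreEnd φ' ((act.baseChange f).ιR a)` and `𝒜.fibreEnd (φ' ∘ f) (act.ιR a)`
for every `a`. [cite: Shimura1998, §12.4 Prop. 26 (proof, p. 109)] -/
theorem fibreEnd_ringAction_baseChange_comp_fibreBaseChangeIso_hom {O : Type v} [CommRing O] (act : RingAction O 𝒜) (a : O) :
    haveI := act.isMonHom a
    haveI := (act.baseChange f).isMonHom a
    (𝒜.baseChange f).fibreEnd φ' ((act.baseChange f).ιR a) ≫ (𝒜.fibreBaseChangeIso f φ').hom =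
      (𝒜.fibreBaseChangeIso f φ').hom ≫ 𝒜.fibreEnd (φ'.comp f) (act.ιR a) := by
  haveI := act.isMonHom a
  haveI : IsMonHom (M := (𝒜.baseChange f).X) (N := (𝒜.baseChange f).X) ((Over.pullback (specMap f)).map (act.ιR a)) :=
    (act.baseChange f).isMonHom a
  exact 𝒜.fibreEnd_baseChange_comp_fibreBaseChangeIso_hom f φ' (act.ιR a)

/-! ## Equal points, equal fibres -/

/-- Fibres at equal points are isomorphic (canonically, `eqToIso`): used with `h : ψ'.comp (algebraMap R R[1/s]) = ψ` to rewrite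
`𝒜.fibre (ψ'.comp _)` (the target of `fibreBaseChangeIso`) as `𝒜.fibre ψ`. [cite: GortzWedhorn2020, Section (4.7)] -/
def fibreCongrIso {φ₁ φ₂ : R →+* κ} (h : φ₁ = φ₂) : 𝒜.fibre φ₁ ≅ 𝒜.fibre φ₂ :=
  eqToIso (congrArg 𝒜.fibre h)

/-- `fibreCongrIso rfl = Iso.refl`. [cite: GortzWedhorn2020, Section (4.7)] -/
@[simp]
theorem fibreCongrIso_rfl (φ : R →+* κ) : 𝒜.fibreCongrIso (rfl : φ = φ) = Iso.refl _ := rfl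

/-- `fibreCongrIso` intertwines the specialised endomorphisms `fibreEnd φ₁ g` and `fibreEnd φ₂ g`.
[cite: Shimura1998, §12.4 Prop. 26 (proof, p. 109)] -/
theorem fibreEnd_comp_fibreCongrIso_hom {φ₁ φ₂ : R →+* κ} (h : φ₁ = φ₂) (g : 𝒜.X ⟶ 𝒜.X) [IsMonHom g] :
    𝒜.fibreEnd φ₁ g ≫ (𝒜.fibreCongrIso h).hom = (𝒜.fibreCongrIso h).hom ≫ 𝒜.fibreEnd φ₂ g := by
  subst h
  simp

/-- **The fibre of the localised model at an extended point is the original fibre**: for `φ' : R' → κ` extending `φ : R → κ` along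
`f` (`φ'.comp f = φ`), `(𝒜.baseChange f).fibre φ' ≅ 𝒜.fibre φ`, intertwining `(𝒜_{R'}).fibreEnd φ' ((act.baseChange f).ιR a)` and
`𝒜.fibreEnd φ (act.ιR a)` for any presented ring action `act`. [cite: Shimura1998, §12.4 Prop. 26 (proof, p. 109)]
[cite: GortzWedhorn2020, Section (4.7)] -/
theorem exists_iso_fibre_baseChange_of_comp_eq {φ : R →+* κ} (hφ : φ'.comp f = φ) {O : Type v} [CommRing O]
    (act : RingAction O 𝒜) :
    ∃ e : (𝒜.baseChange f).fibre φ' ≅ 𝒜.fibre φ, ∀ a : O,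
      haveI := act.isMonHom a
      haveI := (act.baseChange f).isMonHom a
      (𝒜.baseChange f).fibreEnd φ' ((act.baseChange f).ιR a) ≫ e.hom = e.hom ≫ 𝒜.fibreEnd φ (act.ιR a) := by
  subst hφ
  exact ⟨𝒜.fibreBaseChangeIso f φ', fun a => 𝒜.fibreEnd_ringAction_baseChange_comp_fibreBaseChangeIso_hom f φ' act a⟩

end AbelianScheme

end Literature.AlgebraicGeometry.AbelianSchemes

end
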